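import Summits.CriticalPhenomena.PercolationContinuityZ3.Theorems.PercNearOneGluingNoHeavyLowerTailWorstPairExchangeCex
import HarnessLib

/-!
# `NoHeavyLowerTail` (stmt-CriticalPhenomena-4575) — k-cluster line: the two-cluster NEGATIVE CORRELATION of
# van den Berg–Häggström–Kahn does NOT survive a third separated cluster (certified 5-vertex witness)

Support file (prover `prim-hp-7`, hull-port prover #7, technique "k-cluster conditional association";
`--supports stmt-CriticalPhenomena-4575`).  Computational (`native_decide` on 64-term exact rational sums, as in
`PercNearOneGluingNoHeavyLowerTailWorstPairExchangeCex.lean`).  No definitions, no named facts, no sorries (the `Bool`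
test of `D₃` on a reach table `tb` is written out: `!(tb 0).testBit 1 && !(tb 0).testBit 2 && !(tb 1).testBit 2`).

**Background.**  [VandenbergHaggstromKahn2005, Thm. 1.4 / eq. (2)] (tree:
`BHK2006_twoClusterConditionalAssociation.openConn_negCorrelation`, PROVED): for vertices `s ≠ t` and any `a, b`,
with `D = {s ↮ t}`,  `μ(D) · μ(D ∩ {s↔a} ∩ {t↔b}) ≤ μ(D ∩ {s↔a}) · μ(D ∩ {t↔b})` — conditioned on `s ↮ t` the
clusters `C_s`, `C_t` are negatively correlated.  Guards of ONE-SIDED type survive (two-set form,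
`guardedTwoClusterExchange`: extra separations `{s' ↮ t'}` with one vertex on each side).  The hull-port residual
of the crux (`≥ 3` hull ports; seat memo run/shared/lean/prim/prim-hp-7/HP7-KCLUSTER.md) lives in THREE-cluster worlds
`{q | T₁ | T₂}` (a relay and two port blocks pairwise separated), so the first question of the k-cluster line is
which two-cluster inequalities survive the TWO-SIDED guard "a third vertex `u` separated from both `s` and `t`".

**This file: the negative correlation does not.**  Witness (seat lab, exact search over weights in tenths,
re-verified in exact rationals; kit census j048332/j048334): `Fin 5`, `s = 0`, `t = 1`, `u = 2`, `a = 3`, `b = 4`,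
weights `w(0,3) = 1/2`, `w(1,3) = 1/10`, `w(1,4) = 3/5`, `w(2,3) = 7/10`, `w(2,4) = 7/10`, `w(3,4) = 2/5`, all
other pairs `0`.  With `D₃ = {0 ↮ 1} ∩ {0 ↮ 2} ∩ {1 ↮ 2}`:
`μ(D₃) = 747/2500`, `μ(D₃ ∩ {0↔3}) = 2673/50000`, `μ(D₃ ∩ {1↔4}) = 477/6250`,
`μ(D₃ ∩ {0↔3} ∩ {1↔4}) = 729/50000`, and
`μ(D₃ ∩ {0↔3}) · μ(D₃ ∩ {1↔4}) = 1275021/312500000 < μ(D₃) · μ(D₃ ∩ {0↔3} ∩ {1↔4}) = 544563/125000000`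
(difference `172773/625000000 ≈ 2.76·10⁻⁴`; conditionally on `D₃`, `Cov(1{0↔3}, 1{1↔4}) ≈ +3.1·10⁻³`).
Mechanism ("collider" through the third cluster): `u = 2` is adjacent only to `a, b`; on `D₃` the event `{s ↔ a}`
forces the pair `u–a` closed and `{t ↔ b}` forces `u–b` closed, so both connection events make the separation of
`u` EASIER in the same way, and conditioning on it correlates them positively — enough to beat the BHK negative
correlation.  So no proof in a three-cluster world may treat `(C_s(+), C_t(−))`-association as available under the
guard `{u ↮ s} ∩ {u ↮ t}`; which exchange CELLS do survive the two-sided guard is censused separately (seat memo,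
kit j048332).

* `ThreeClusterCex.real_D3_inter` — evaluation of `μ(D₃ ∩ E)` for any event `E` given by a `Bool` test on reach tables;
* `ThreeClusterCex.violation_of_check` — one decidable rational fact ⇒ the violating instance;
* `threeClusterNegCorr_cex` — the instance (`∃ w` over `Fin 5`);
* `threeClusterNegCorr_false` — `¬`(eq. (2) with the two-sided guard), for all finite weighted graphs.
-/

namespace Summit.CriticalPhenomena.PercolationContinuityZ3.Theorems

open MeasureTheory
open Literature.Probability.LatticeModels Literature.Probability.Percolation
open Summit.CriticalPhenomena.PercolationContinuityZ3.Theorems.AdditiveGluing.Negative.Cert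

namespace ThreeClusterCex

open WorstPairExchangeCex (real_eq_wcount)

/-- **Evaluation of `μ(D₃ ∩ E)`.**  For a weighted edge list `l` on `Fin 5` (distinct pairs, weights in `[0,1]`) and an
event `E` whose per-configuration indicator is the `Bool` test `f` on the reach table,
`μ(D₃ ∩ E)` is the exact weighted count of `(test of D₃) && f`. [this file] -/
theorem real_D3_inter {l : List (Fin 5 × Fin 5 × ℚ)} (hnd : (wPairs l).Nodup)
    (hq : ∀ e ∈ l, 0 ≤ e.2.2 ∧ e.2.2 ≤ 1) (f : List ℕ → Bool) (E : Set (BondConfig (Fin 5)))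
    (hfE : ∀ ω : List (Fin 5 × Fin 5), f (reachTable 5 ω) = true ↔ (↑(Eset ω) : Set (Sym2 (Fin 5))) ∈ E) :
    (prodBernoulli (wOfList l)).real
        ((openConn (0 : Fin 5) (1 : Fin 5) : Set (BondConfig (Fin 5)))ᶜ ∩ (openConn (0 : Fin 5) (2 : Fin 5))ᶜ ∩
          (openConn (1 : Fin 5) (2 : Fin 5))ᶜ ∩ E) =
      ((((wtabs 5 l).map fun t => if ((!(t.1.getD 0 0).testBit 1 && !(t.1.getD 0 0).testBit 2 && !(t.1.getD 1 0).testBit 2) && f t.1) then t.2 else 0).sum : ℚ) : ℝ) := by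
  refine real_eq_wcount hnd hq (fun tb => (!(tb.getD 0 0).testBit 1 && !(tb.getD 0 0).testBit 2 && !(tb.getD 1 0).testBit 2) && f tb) _ fun ω => ?_
  have h01 : ((reachTable 5 ω).getD 0 0).testBit 1 = true ↔
      (↑(Eset ω) : Set (Sym2 (Fin 5))) ∈ openConn (0 : Fin 5) (1 : Fin 5) :=
    testBit_reachTable_iff_mem_openConn ω (0 : Fin 5) (1 : Fin 5)
  have h02 : ((reachTable 5 ω).getD 0 0).testBit 2 = true ↔
      (↑(Eset ω) : Set (Sym2 (Fin 5))) ∈ openConn (0 : Fin 5) (2 : Fin 5) :=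
    testBit_reachTable_iff_mem_openConn ω (0 : Fin 5) (2 : Fin 5)
  have h12 : ((reachTable 5 ω).getD 1 0).testBit 2 = true ↔
      (↑(Eset ω) : Set (Sym2 (Fin 5))) ∈ openConn (1 : Fin 5) (2 : Fin 5) :=
    testBit_reachTable_iff_mem_openConn ω (1 : Fin 5) (2 : Fin 5)
  have hf := hfE ω
  simp only [Bool.and_eq_true, Bool.not_eq_true', Set.mem_inter_iff, Set.mem_compl_iff]
  constructor
  · rintro ⟨⟨⟨h1, h2⟩, h3⟩, h4⟩
    refine ⟨⟨⟨fun h => ?_, fun h => ?_⟩, fun h => ?_⟩, hf.1 h4⟩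
    · rw [← h01] at h; rw [h] at h1; exact Bool.noConfusion h1
    · rw [← h02] at h; rw [h] at h2; exact Bool.noConfusion h2
    · rw [← h12] at h; rw [h] at h3; exact Bool.noConfusion h3
  · rintro ⟨⟨⟨h1, h2⟩, h3⟩, h4⟩
    refine ⟨⟨⟨?_, ?_⟩, ?_⟩, hf.2 h4⟩
    · cases h : ((reachTable 5 ω).getD 0 0).testBit 1
      · rfl
      · exact absurd (h01.1 h) h1
    · cases h : ((reachTable 5 ω).getD 0 0).testBit 2
      · rfl
      · exact absurd (h02.1 h) h2
    · cases h : ((reachTable 5 ω).getD 1 0).testBit 2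
      · rfl
      · exact absurd (h12.1 h) h3

/-- `μ(D₃)` as an exact weighted count. [this file] -/
theorem real_D3 {l : List (Fin 5 × Fin 5 × ℚ)} (hnd : (wPairs l).Nodup) (hq : ∀ e ∈ l, 0 ≤ e.2.2 ∧ e.2.2 ≤ 1) :
    (prodBernoulli (wOfList l)).real
        ((openConn (0 : Fin 5) (1 : Fin 5) : Set (BondConfig (Fin 5)))ᶜ ∩ (openConn (0 : Fin 5) (2 : Fin 5))ᶜ ∩
          (openConn (1 : Fin 5) (2 : Fin 5))ᶜ) =
      ((((wtabs 5 l).map fun t => if ((!(t.1.getD 0 0).testBit 1 && !(t.1.getD 0 0).testBit 2 && !(t.1.getD 1 0).testBit 2) && true) then t.2 else 0).sum : ℚ) : ℝ) := by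
  have key := real_D3_inter hnd hq (fun _ => true) Set.univ (fun ω => by simp)
  rwa [Set.inter_univ] at key

/-- `μ(D₃ ∩ {0 ↔ 3})` as an exact weighted count. [this file] -/
theorem real_D3_sa {l : List (Fin 5 × Fin 5 × ℚ)} (hnd : (wPairs l).Nodup) (hq : ∀ e ∈ l, 0 ≤ e.2.2 ∧ e.2.2 ≤ 1) :
    (prodBernoulli (wOfList l)).real
        ((openConn (0 : Fin 5) (1 : Fin 5) : Set (BondConfig (Fin 5)))ᶜ ∩ (openConn (0 : Fin 5) (2 : Fin 5))ᶜ ∩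
          (openConn (1 : Fin 5) (2 : Fin 5))ᶜ ∩ openConn (0 : Fin 5) (3 : Fin 5)) =
      ((((wtabs 5 l).map fun t => if ((!(t.1.getD 0 0).testBit 1 && !(t.1.getD 0 0).testBit 2 && !(t.1.getD 1 0).testBit 2) && (t.1.getD 0 0).testBit 3) then t.2 else 0).sum : ℚ) : ℝ) :=
  real_D3_inter hnd hq (fun tb => (tb.getD 0 0).testBit 3) _
    (fun ω => testBit_reachTable_iff_mem_openConn ω (0 : Fin 5) (3 : Fin 5))

/-- `μ(D₃ ∩ {1 ↔ 4})` as an exact weighted count. [this file] -/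
theorem real_D3_tb {l : List (Fin 5 × Fin 5 × ℚ)} (hnd : (wPairs l).Nodup) (hq : ∀ e ∈ l, 0 ≤ e.2.2 ∧ e.2.2 ≤ 1) :
    (prodBernoulli (wOfList l)).real
        ((openConn (0 : Fin 5) (1 : Fin 5) : Set (BondConfig (Fin 5)))ᶜ ∩ (openConn (0 : Fin 5) (2 : Fin 5))ᶜ ∩
          (openConn (1 : Fin 5) (2 : Fin 5))ᶜ ∩ openConn (1 : Fin 5) (4 : Fin 5)) =
      ((((wtabs 5 l).map fun t => if ((!(t.1.getD 0 0).testBit 1 && !(t.1.getD 0 0).testBit 2 && !(t.1.getD 1 0).testBit 2) && (t.1.getD 1 0).testBit 4) then t.2 else 0).sum : ℚ) : ℝ) :=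
  real_D3_inter hnd hq (fun tb => (tb.getD 1 0).testBit 4) _
    (fun ω => testBit_reachTable_iff_mem_openConn ω (1 : Fin 5) (4 : Fin 5))

/-- `μ(D₃ ∩ ({0 ↔ 3} ∩ {1 ↔ 4}))` as an exact weighted count. [this file] -/
theorem real_D3_sa_tb {l : List (Fin 5 × Fin 5 × ℚ)} (hnd : (wPairs l).Nodup)
    (hq : ∀ e ∈ l, 0 ≤ e.2.2 ∧ e.2.2 ≤ 1) :
    (prodBernoulli (wOfList l)).real
        ((openConn (0 : Fin 5) (1 : Fin 5) : Set (BondConfig (Fin 5)))ᶜ ∩ (openConn (0 : Fin 5) (2 : Fin 5))ᶜ ∩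
          (openConn (1 : Fin 5) (2 : Fin 5))ᶜ ∩ (openConn (0 : Fin 5) (3 : Fin 5) ∩ openConn (1 : Fin 5) (4 : Fin 5))) =
      ((((wtabs 5 l).map fun t =>
          if ((!(t.1.getD 0 0).testBit 1 && !(t.1.getD 0 0).testBit 2 && !(t.1.getD 1 0).testBit 2) && ((t.1.getD 0 0).testBit 3 && (t.1.getD 1 0).testBit 4)) then t.2 else 0).sum : ℚ) : ℝ) :=
  real_D3_inter hnd hq (fun tb => (tb.getD 0 0).testBit 3 && (tb.getD 1 0).testBit 4) _ (fun ω => by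
    have h03 : ((reachTable 5 ω).getD 0 0).testBit 3 = true ↔
        (↑(Eset ω) : Set (Sym2 (Fin 5))) ∈ openConn (0 : Fin 5) (3 : Fin 5) :=
      testBit_reachTable_iff_mem_openConn ω (0 : Fin 5) (3 : Fin 5)
    have h14 : ((reachTable 5 ω).getD 1 0).testBit 4 = true ↔
        (↑(Eset ω) : Set (Sym2 (Fin 5))) ∈ openConn (1 : Fin 5) (4 : Fin 5) :=
      testBit_reachTable_iff_mem_openConn ω (1 : Fin 5) (4 : Fin 5)
    rw [Bool.and_eq_true, Set.mem_inter_iff]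
    exact Iff.and h03 h14)

/-- **From one checkable rational fact to the violating instance.**  If the exact counts satisfy
`count(D₃, 0↔3) · count(D₃, 1↔4) < count(D₃) · count(D₃, 0↔3, 1↔4)` then under `prodBernoulli (wOfList l)` the two
connection events are strictly POSITIVELY correlated given `D₃`. [this file] -/
theorem violation_of_check (l : List (Fin 5 × Fin 5 × ℚ)) (hnd : (wPairs l).Nodup)
    (hq : ∀ e ∈ l, 0 ≤ e.2.2 ∧ e.2.2 ≤ 1)
    (hlt : ((wtabs 5 l).map fun t => if ((!(t.1.getD 0 0).testBit 1 && !(t.1.getD 0 0).testBit 2 && !(t.1.getD 1 0).testBit 2) && (t.1.getD 0 0).testBit 3) then t.2 else 0).sum *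
        ((wtabs 5 l).map fun t => if ((!(t.1.getD 0 0).testBit 1 && !(t.1.getD 0 0).testBit 2 && !(t.1.getD 1 0).testBit 2) && (t.1.getD 1 0).testBit 4) then t.2 else 0).sum <
      ((wtabs 5 l).map fun t => if ((!(t.1.getD 0 0).testBit 1 && !(t.1.getD 0 0).testBit 2 && !(t.1.getD 1 0).testBit 2) && true) then t.2 else 0).sum *
        ((wtabs 5 l).map fun t =>
          if ((!(t.1.getD 0 0).testBit 1 && !(t.1.getD 0 0).testBit 2 && !(t.1.getD 1 0).testBit 2) && ((t.1.getD 0 0).testBit 3 && (t.1.getD 1 0).testBit 4)) then t.2 else 0).sum) :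
    (prodBernoulli (wOfList l)).real
        ((openConn (0 : Fin 5) (1 : Fin 5) : Set (BondConfig (Fin 5)))ᶜ ∩ (openConn (0 : Fin 5) (2 : Fin 5))ᶜ ∩
          (openConn (1 : Fin 5) (2 : Fin 5))ᶜ ∩ openConn (0 : Fin 5) (3 : Fin 5)) *
      (prodBernoulli (wOfList l)).real
        ((openConn (0 : Fin 5) (1 : Fin 5) : Set (BondConfig (Fin 5)))ᶜ ∩ (openConn (0 : Fin 5) (2 : Fin 5))ᶜ ∩
          (openConn (1 : Fin 5) (2 : Fin 5))ᶜ ∩ openConn (1 : Fin 5) (4 : Fin 5)) <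
    (prodBernoulli (wOfList l)).real
        ((openConn (0 : Fin 5) (1 : Fin 5) : Set (BondConfig (Fin 5)))ᶜ ∩ (openConn (0 : Fin 5) (2 : Fin 5))ᶜ ∩
          (openConn (1 : Fin 5) (2 : Fin 5))ᶜ) *
      (prodBernoulli (wOfList l)).real
        ((openConn (0 : Fin 5) (1 : Fin 5) : Set (BondConfig (Fin 5)))ᶜ ∩ (openConn (0 : Fin 5) (2 : Fin 5))ᶜ ∩
          (openConn (1 : Fin 5) (2 : Fin 5))ᶜ ∩ (openConn (0 : Fin 5) (3 : Fin 5) ∩ openConn (1 : Fin 5) (4 : Fin 5))) := by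
  rw [real_D3_sa hnd hq, real_D3_tb hnd hq, real_D3 hnd hq, real_D3_sa_tb hnd hq]
  exact_mod_cast hlt

end ThreeClusterCex

open ThreeClusterCex in
/-- **A third separated cluster reverses the BHK negative correlation: the instance.**  There is a weight function `w`
on the pairs of `Fin 5` — `w(0,3) = 1/2`, `w(1,3) = 1/10`, `w(1,4) = 3/5`, `w(2,3) = 7/10`, `w(2,4) = 7/10`, `w(3,4) = 2/5`,
all other pairs `0` — such that for `μ = prodBernoulli w` and
`D₃ = {0 ↮ 1} ∩ {0 ↮ 2} ∩ {1 ↮ 2}`: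
`μ(D₃ ∩ {0↔3}) · μ(D₃ ∩ {1↔4}) < μ(D₃) · μ(D₃ ∩ {0↔3} ∩ {1↔4})`
(`1275021/312500000 < 544563/125000000`, exact rationals by `native_decide`). [this file] -/
theorem threeClusterNegCorr_cex : ∃ w : Sym2 (Fin 5) → unitInterval,
    (prodBernoulli w).real
        ((openConn (0 : Fin 5) (1 : Fin 5) : Set (BondConfig (Fin 5)))ᶜ ∩ (openConn (0 : Fin 5) (2 : Fin 5))ᶜ ∩
          (openConn (1 : Fin 5) (2 : Fin 5))ᶜ ∩ openConn (0 : Fin 5) (3 : Fin 5)) *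
      (prodBernoulli w).real
        ((openConn (0 : Fin 5) (1 : Fin 5) : Set (BondConfig (Fin 5)))ᶜ ∩ (openConn (0 : Fin 5) (2 : Fin 5))ᶜ ∩
          (openConn (1 : Fin 5) (2 : Fin 5))ᶜ ∩ openConn (1 : Fin 5) (4 : Fin 5)) <
    (prodBernoulli w).real
        ((openConn (0 : Fin 5) (1 : Fin 5) : Set (BondConfig (Fin 5)))ᶜ ∩ (openConn (0 : Fin 5) (2 : Fin 5))ᶜ ∩
          (openConn (1 : Fin 5) (2 : Fin 5))ᶜ) *
      (prodBernoulli w).real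
        ((openConn (0 : Fin 5) (1 : Fin 5) : Set (BondConfig (Fin 5)))ᶜ ∩ (openConn (0 : Fin 5) (2 : Fin 5))ᶜ ∩
          (openConn (1 : Fin 5) (2 : Fin 5))ᶜ ∩ (openConn (0 : Fin 5) (3 : Fin 5) ∩ openConn (1 : Fin 5) (4 : Fin 5))) :=
  ⟨_, violation_of_check
    [(0, 3, 1/2), (1, 3, 1/10), (1, 4, 3/5), (2, 3, 7/10), (2, 4, 7/10), (3, 4, 2/5)] (by decide)
    (by
      intro e he
      simp only [List.mem_cons, List.not_mem_nil, or_false] at he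
      rcases he with rfl | rfl | rfl | rfl | rfl | rfl <;> norm_num)
    (by native_decide)⟩

/-- **No-go for the k-cluster line: the two-cluster negative correlation of van den Berg–Häggström–Kahn
(Thm. 1.4 / eq. (2), tree `BHK2006_twoClusterConditionalAssociation.openConn_negCorrelation`) does NOT survive
conditioning on a third cluster separated from both.**  It is false that for every finite weighted graph and all
pairwise distinct vertices `s, t, u, a, b`, with `D₃ = {s ↮ t} ∩ {s ↮ u} ∩ {t ↮ u}`,
`μ(D₃) · μ(D₃ ∩ {s↔a} ∩ {t↔b}) ≤ μ(D₃ ∩ {s↔a}) · μ(D₃ ∩ {t↔b})`.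
Witness `threeClusterNegCorr_cex` (`n = 5`, `(s,t,u,a,b) = (0,1,2,3,4)`). [this file] -/
theorem threeClusterNegCorr_false :
    ¬ (∀ (n : ℕ) (w : Sym2 (Fin n) → unitInterval) (s t u a b : Fin n), [s, t, u, a, b].Nodup →
      (prodBernoulli w).real ((openConn s t : Set (BondConfig (Fin n)))ᶜ ∩ (openConn s u)ᶜ ∩ (openConn t u)ᶜ) *
        (prodBernoulli w).real
          ((openConn s t : Set (BondConfig (Fin n)))ᶜ ∩ (openConn s u)ᶜ ∩ (openConn t u)ᶜ ∩ (openConn s a ∩ openConn t b)) ≤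
      (prodBernoulli w).real ((openConn s t : Set (BondConfig (Fin n)))ᶜ ∩ (openConn s u)ᶜ ∩ (openConn t u)ᶜ ∩ openConn s a) *
        (prodBernoulli w).real
          ((openConn s t : Set (BondConfig (Fin n)))ᶜ ∩ (openConn s u)ᶜ ∩ (openConn t u)ᶜ ∩ openConn t b)) := by
  intro h
  obtain ⟨w, hgt⟩ := threeClusterNegCorr_cex
  have hle := h 5 w 0 1 2 3 4 (by decide)
  exact absurd hle (not_le.2 hgt)

end Summit.CriticalPhenomena.PercolationContinuityZ3.Theorems
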